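import Summits.KontsevichZagierPeriods.Zeta5Search.LaiSweepShard

/-!
# `κ₃` sweep certificate — shard file 037 of 127 (shards 259–265 of 889)

HONEST FRAMING. Systematic search; no irrationality claim unless certified. This file only checks,
by `decide +kernel`, shards 259–265 of the order-cell sweep of the `κ₃` point `(74, 2180, 444; δ74)`
(engine `LaiSweepEngine`, soundness `LaiSweepJump/Free/Eval/Shard/Kappa3`; a shard is `⟨regime, n,
p, q, p', q', Lo, Up⟩`: `n` cells from `p/q` to `p'/q'` with integer rate sums in `[Lo, Up]`, `K =
128`, `D = 2^40`). It draws NO conclusion: only the capstone `LaiKappa3SweepCert`, which needs all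
127 shard files, does. Kernel cost of this file ≈ 560 cells × 0.3 s.
-/

namespace Summit.KontsevichZagierPeriods.Zeta5Search.Sweep

set_option maxHeartbeats 100000000 in
/-- Shard 259: 80 cells of regime B from `65/313` to `75/359`.
[cite: Lai2024BallRivoal, §4 Lemma 4.3] -/
theorem shard259 :
    Shard.check 128 (2^40)
      ⟨true, 80, 65, 313, 75, 359, 31175807123122, 32145130111266⟩ = true := by
  decide +kernel

set_option maxHeartbeats 100000000 in
/-- Shard 260: 80 cells of regime B from `75/359` to `91/433`.
[cite: Lai2024BallRivoal, §4 Lemma 4.3] -/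
theorem shard260 :
    Shard.check 128 (2^40)
      ⟨true, 80, 75, 359, 91, 433, 31114339602733, 32094734313081⟩ = true := by
  decide +kernel

set_option maxHeartbeats 100000000 in
/-- Shard 261: 80 cells of regime B from `91/433` to `85/402`.
[cite: Lai2024BallRivoal, §4 Lemma 4.3] -/
theorem shard261 :
    Shard.check 128 (2^40)
      ⟨true, 80, 91, 433, 85, 402, 31723890734216, 32738620753045⟩ = true := by
  decide +kernel

set_option maxHeartbeats 100000000 in
/-- Shard 262: 80 cells of regime B from `85/402` to `67/315`.
[cite: Lai2024BallRivoal, §4 Lemma 4.3] -/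
theorem shard262 :
    Shard.check 128 (2^40)
      ⟨true, 80, 85, 402, 67, 315, 30965078883093, 31968380213506⟩ = true := by
  decide +kernel

set_option maxHeartbeats 100000000 in
/-- Shard 263: 80 cells of regime B from `67/315` to `46/215`.
[cite: Lai2024BallRivoal, §4 Lemma 4.3] -/
theorem shard263 :
    Shard.check 128 (2^40)
      ⟨true, 80, 67, 315, 46, 215, 30734185306227, 31742986110666⟩ = true := by
  decide +kernel

set_option maxHeartbeats 100000000 in
/-- Shard 264: 80 cells of regime B from `46/215` to `517/2402`.
[cite: Lai2024BallRivoal, §4 Lemma 4.3] -/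
theorem shard264 :
    Shard.check 128 (2^40)
      ⟨true, 80, 46, 215, 517, 2402, 31296941004759, 32340351288846⟩ = true := by
  decide +kernel

set_option maxHeartbeats 100000000 in
/-- Shard 265: 80 cells of regime B from `517/2402` to `260/1201`.
[cite: Lai2024BallRivoal, §4 Lemma 4.3] -/
theorem shard265 :
    Shard.check 128 (2^40)
      ⟨true, 80, 517, 2402, 260, 1201, 30282485896030, 31304270797069⟩ = true := by
  decide +kernel

/-- The checked shards of this file, in order. [folklore] -/
def shards037 : List (CheckedShard 128 (2^40)) :=
  [⟨_, shard259⟩, ⟨_, shard260⟩, ⟨_, shard261⟩, ⟨_, shard262⟩, ⟨_, shard263⟩,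
    ⟨_, shard264⟩, ⟨_, shard265⟩]

end Summit.KontsevichZagierPeriods.Zeta5Search.Sweep
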